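import Summits.BirchSwinnertonDyer.BirchSwinnertonDyer.Theorems.UniversalToricDescentThinCombSizeRigidity
import HarnessLib

/-!
# SIZE INVARIANCE OF ♯♯-FRAMES: the `3`-adic sizes `‖X‖`, `‖Y‖` of the two gradings are the SAME for any two non-zero ♯♯-frames of the same
# datum, and the complex period `Ω_K` of a frame is absorbed by the gradings (helper on the rational wall `RationalSplitIMCInclusionAtThree`,
# stmt-BirchSwinnertonDyer-24207, line `ratwall_thin_comb` v11/v12; cell `pub/bsd-wall`, LEAD `cruxlead-24207` g39; `--supports
# stmt-BirchSwinnertonDyer-24207`; nothing is closed; BSD is not proved)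

WHY THIS FILE. The line's first stub ((E) `ToricFrameExistsAtThree` in v11, (E|L) `ToricFrameExistsOfBDPFrameAtThree` in v12) asks for a
♯♯-frame `L₂ ∈ R₀⟦T₁⟧⟦T₂⟧` with SOME constants `(C, X, Y) ∈ (ℂ₃ˣ)³` and SOME period `Ω_K′ ≠ 0` (`IsToricTwoVarLFunctionUpTo₂ C X Y … Ω_K′ L₂`).
The structure theory landed so far pins the RATIO of the gradings (`‖Y/X‖ = |N·|d_K|/4|₃`, `…ThinComb.SizeRigidity`), the frame given its constants
(`…ThinComb.FrameUniqueness`) and the behaviour under the frame involution (`…ThinComb.FrameFunctionalEquation`), but left open whether the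
ABSOLUTE sizes `‖X‖`, `‖Y‖` — the exponential `3`-adic growth rates of the interpolated values in `a` and in `b`, i.e. the analytic «μ-slopes» of
the branch — can differ between two frames (they are insensitive to `C`, which absorbs `3^{±c}`), and what the period `Ω_K′` contributes. This file
settles both:

* §1 **`isToricTwoVarLFunctionUpTo₂_of_period`** (any `p`) — THE PERIOD IS ABSORBED BY THE GRADINGS: a `(C, X, Y)`-frame for the period `Ω_K` is a
  `(C, X·ρ, Y·ρ)`-frame for ANY other period `Ω_K′ ≠ 0`, `ρ = ι⁻¹((Ω_K′/Ω_K)²)` (the display carries `Ω_K^{−2(a+b)} = (Ω_K^{−2})^a (Ω_K^{−2})^b`).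
  In particular the `∃ Ω_K′` of (E)/(E|L) is REDUNDANT (`Ω_K′ := 1` loses nothing: `isToricTwoVarLFunctionUpTo₂_period_one`).
* §2 **`norm_le_norm_of_isToricTwoVarLFunctionUpTo₂_pair`** (`p = 3`, Jacquet's cone fact BY NAME) — ONE-SIDED SIZE COMPARISON: if `L` is a
  `(C, X, Y)`-frame with `C, X, Y ≠ 0` (possibly `L = 0`) and `L′ ≠ 0` is a `(C′, X′, Y′)`-frame of the SAME datum and period, then `‖X‖ ≤ ‖X′‖`.
  PROOF. On the grid supply (`…ThinComb.GridSupply`: types `(m(i+1), −m(j+1))`, points `(v₁^{j+1}u^{i+1} − 1, v₂^{j+1} − 1)`) both frames interpolate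
  the SAME display values `D_{ij}`, so `L′(P_{ij})·C X^a Y^b = L(P_{ij})·C′ X′^a Y′^b` with `‖L(P_{ij})‖ ≤ 1` (`…ValueLimits.norm_le_one_of_hasValueAt₂`);
  if `‖X′‖ < ‖X‖` the values of `L′` decay geometrically in `i` along every fibre `j`, hence vanish (decay lemma
  `…ValueLimits.eq_zero_of_hasValueAt₂_of_norm_le_geometric`: the fibre points accumulate, `u^{3ⁿ} → 1`), and the fibred identity principle
  (`…ReflectionTransfer.unr_eq_zero_of_infinite_zeros₂_innerFibred`) gives `L′ = 0`.
* §3 **`norm_eq_norm_of_isToricTwoVarLFunctionUpTo₂_pair`** — SIZE INVARIANCE: two NON-ZERO frames of the same datum and period, all constants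
  non-zero, have `‖X‖ = ‖X′‖` AND `‖Y‖ = ‖Y′‖` (§2 both ways, then size rigidity `‖Y‖ = ‖X·κ̂‖` for each); with DIFFERENT periods `Ω_K, Ω_K′` the
  invariants are `‖X·ι⁻¹(Ω_K⁻²)‖` and `‖Y·ι⁻¹(Ω_K⁻²)‖` (`norm_mul_eq_norm_mul_of_isToricTwoVarLFunctionUpTo₂_pair`, via §1).
  CONSEQUENCE for the typer / disprover of (E)/(E|L): the constants of a frame are canonical up to `S¹ × S¹ × (3-power in C)`: any two constructions
  (Hida's Rankin–Selberg measure, an integral refinement of Liu–Zhang–Zhang's distribution, …) must produce gradings of the same `3`-adic sizes; an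
  attack on existence cannot use the freedom of `‖X‖`.

HONEST SCOPE: statements about the interpolation predicate, conditional on the named print fact `jacquet1972_functionalEquation_rankinSelbergHecke_cone`
(continuations on the cone, used by the grid supply); nothing here is evidence that a frame exists at an additive split `3`; BSD is proved for no curve;
24207 / 20395 / 20186 / 32493 OPEN.

References: [cite: HaoLoeffler2025, Thm. 3.5 and remark (arXiv:2405.12611; uniqueness by density, the graded prefactor)] [cite: CastellaWan2023, §2.4 Thm. 2.11 (arXiv:1607.02019)]
[cite: Gouvea1993PadicNumbers, §5.6 Cor. 5.6.3–5.6.4] [cite: Jacquet1972, §19 Cor. 19.15] [cite: Hida1988AIF, §5 Lemma 5.2 (ii)]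
-/

set_option linter.dupNamespace false
set_option autoImplicit false

noncomputable section

open scoped Classical MatrixGroups
open Filter Topology

namespace Summit.BirchSwinnertonDyer.BirchSwinnertonDyer.Theorems.UniversalToricDescentThinComb.FrameSizeInvariance

open NumberField IsDedekindDomain Field
open Literature.NumberTheory.EllipticCurves Literature.NumberTheory.GaloisRepresentations
open Summit.BirchSwinnertonDyer.Rank1Residual.X11b.Halves
open Summit.BirchSwinnertonDyer.BirchSwinnertonDyer.Theorems.UniversalToricDescentThinComb

/-! ### §1. The period is absorbed by the gradings (any `p`) -/

section Period

variable {p : ℕ} [Fact p.Prime] {K : Type} [Field K] [NumberField K] {N : ℕ}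

omit [Fact p.Prime] in
/-- **Change of period in the display**: `v(Ω_K) = v(Ω_K′) · ((Ω_K′/Ω_K)²)^a · ((Ω_K′/Ω_K)²)^b` for the complex part of Castella–Wan's
interpolation value (it carries the factor `Ω_K^{−2(a+b)}`). [cite: CastellaWan2023, §2.4 Thm. 2.11 (arXiv:1607.02019; the display)] -/
theorem toricInterpolationValue_eq_mul_of_period (f : CuspForm (CongruenceSubgroup.Gamma0 N) 2) (𝔭 𝔭' : HeightOneSpectrum (𝓞 K))
    (ψ : HeckeCharacter K) (a b : ℕ) {ΩK ΩK' : ℂ} (hΩK : ΩK ≠ 0) (hΩK' : ΩK' ≠ 0) (Lval : ℂ) :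
    toricInterpolationValue p f 𝔭 𝔭' ψ a b ΩK Lval =
      toricInterpolationValue p f 𝔭 𝔭' ψ a b ΩK' Lval * ((ΩK' / ΩK) ^ 2) ^ a * ((ΩK' / ΩK) ^ 2) ^ b := by
  have hπ : ((Real.pi : ℂ)) ≠ 0 := by exact_mod_cast Real.pi_ne_zero
  have hπn : ((Real.pi : ℂ)) ^ (2 * b + 1) ≠ 0 := pow_ne_zero _ hπ
  have hK2 : ΩK ^ (2 * (a + b)) ≠ 0 := pow_ne_zero _ hΩK
  have hK'2 : ΩK' ^ (2 * (a + b)) ≠ 0 := pow_ne_zero _ hΩK'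
  have e : ((ΩK' / ΩK) ^ 2) ^ a * ((ΩK' / ΩK) ^ 2) ^ b = ΩK' ^ (2 * (a + b)) / ΩK ^ (2 * (a + b)) := by
    rw [← pow_mul, ← pow_mul, ← pow_add, div_pow, show 2 * a + 2 * b = 2 * (a + b) by ring]
  rw [mul_assoc, e]
  simp only [toricInterpolationValue]
  rw [div_mul_div_comm, div_eq_div_iff (mul_ne_zero hπn hK2) (mul_ne_zero (mul_ne_zero hπn hK'2) hK2)]
  ring

/-- **THE PERIOD IS ABSORBED BY THE GRADINGS.** If `L₂` is a ♯♯-frame with constants `(C, X, Y)` for the period `Ω_K ≠ 0`, then for every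
`Ω_K′ ≠ 0` it is a ♯♯-frame with constants `(C, X·ρ, Y·ρ)` for the period `Ω_K′`, `ρ = ι⁻¹((Ω_K′/Ω_K)²)`.
[cite: CastellaWan2023, §2.4 Thm. 2.11 (arXiv:1607.02019; the display)] -/
theorem isToricTwoVarLFunctionUpTo₂_of_period {ι : PadicAlgCl p ≃+* ℂ} {𝔭 𝔭' : HeightOneSpectrum (𝓞 K)} {κ₁ κ₂ : ZpExtension K p}
    {γ₁ γ₂ : absoluteGaloisGroup K} {f : CuspForm (CongruenceSubgroup.Gamma0 N) 2} {ΩK ΩK' : ℂ} {C X Y : ℂ_[p]}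
    {L₂ : PowerSeries (UnrSeries p)} (hΩK : ΩK ≠ 0) (hΩK' : ΩK' ≠ 0)
    (hL : IsToricTwoVarLFunctionUpTo₂ C X Y ι 𝔭 𝔭' κ₁ κ₂ γ₁ γ₂ f ΩK L₂) :
    IsToricTwoVarLFunctionUpTo₂ C (X * (((ι.symm ((ΩK' / ΩK) ^ 2) : PadicAlgCl p)) : ℂ_[p]))
      (Y * (((ι.symm ((ΩK' / ΩK) ^ 2) : PadicAlgCl p)) : ℂ_[p])) ι 𝔭 𝔭' κ₁ κ₂ γ₁ γ₂ f ΩK' L₂ := by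
  intro ψ a b ha hb hinf hunr r hr hκ L hLd hLe
  have hv := hL ψ a b ha hb hinf hunr r hr hκ L hLd hLe
  rw [toricInterpolationValue_eq_mul_of_period f 𝔭 𝔭' ψ a b hΩK hΩK' (L 1)] at hv
  generalize (ΩK' / ΩK) ^ 2 = ρc at hv ⊢
  generalize toricInterpolationValue p f 𝔭 𝔭' ψ a b ΩK' (L 1) = v' at hv ⊢
  rw [map_mul, map_mul, map_pow, map_pow, PadicComplex.coe_eq, map_mul, map_mul, map_pow, map_pow] at hv
  rw [PadicComplex.coe_eq, PadicComplex.coe_eq]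
  have e : C * (X * algebraMap (PadicAlgCl p) ℂ_[p] (ι.symm ρc)) ^ a * (Y * algebraMap (PadicAlgCl p) ℂ_[p] (ι.symm ρc)) ^ b *
        algebraMap (PadicAlgCl p) ℂ_[p] (ι.symm v') =
      C * X ^ a * Y ^ b * (algebraMap (PadicAlgCl p) ℂ_[p] (ι.symm v') * algebraMap (PadicAlgCl p) ℂ_[p] (ι.symm ρc) ^ a *
        algebraMap (PadicAlgCl p) ℂ_[p] (ι.symm ρc) ^ b) := by
    ring
  rw [e]
  exact hv

/-- **`Ω_K′ := 1` loses nothing**: a `(C, X, Y)`-frame for the period `Ω_K ≠ 0` is a `(C, X·ι⁻¹(Ω_K⁻²), Y·ι⁻¹(Ω_K⁻²))`-frame for the period `1`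
— the `∃ Ω_K′` in the stubs (E)/(E|L) is redundant. [cite: CastellaWan2023, §2.4 Thm. 2.11 (arXiv:1607.02019; the display)] -/
theorem isToricTwoVarLFunctionUpTo₂_period_one {ι : PadicAlgCl p ≃+* ℂ} {𝔭 𝔭' : HeightOneSpectrum (𝓞 K)} {κ₁ κ₂ : ZpExtension K p}
    {γ₁ γ₂ : absoluteGaloisGroup K} {f : CuspForm (CongruenceSubgroup.Gamma0 N) 2} {ΩK : ℂ} {C X Y : ℂ_[p]}
    {L₂ : PowerSeries (UnrSeries p)} (hΩK : ΩK ≠ 0)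
    (hL : IsToricTwoVarLFunctionUpTo₂ C X Y ι 𝔭 𝔭' κ₁ κ₂ γ₁ γ₂ f ΩK L₂) :
    IsToricTwoVarLFunctionUpTo₂ C (X * (((ι.symm ((ΩK ^ 2)⁻¹) : PadicAlgCl p)) : ℂ_[p]))
      (Y * (((ι.symm ((ΩK ^ 2)⁻¹) : PadicAlgCl p)) : ℂ_[p])) ι 𝔭 𝔭' κ₁ κ₂ γ₁ γ₂ f 1 L₂ := by
  have h := isToricTwoVarLFunctionUpTo₂_of_period hΩK one_ne_zero hL
  rwa [one_div, inv_pow] at h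

end Period

/-! ### §2. One-sided size comparison of two frames (`p = 3`) -/

variable {K : Type} [Field K] [NumberField K]

/-- **ONE-SIDED SIZE COMPARISON.** `K` imaginary quadratic Heegner for `N`, `3 = 𝔭𝔭′` with `𝔭` of degree one induced by `ι′`, `(κ₁, κ₂; γ₁, γ₂)`
a generator pair with `κ₁` unramified outside `𝔭`, `f = Dt.f`; Jacquet's cone fact BY NAME. If `L` is a ♯♯-frame with constants `(C, X, Y)`,
`C, X, Y ≠ 0` (zero or not), and `L′ ≠ 0` is a ♯♯-frame with constants `(C′, X′, Y′)` of the same datum and period, then `‖X‖ ≤ ‖X′‖`: on the grid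
supply `L′(P_{ij})·C X^{m(i+1)} Y^{m(j+1)} = L(P_{ij})·C′ X′^{m(i+1)} Y′^{m(j+1)}`, `‖L(P_{ij})‖ ≤ 1`, and `‖X′‖ < ‖X‖` would make the values of
`L′` decay geometrically along every fibre, killing `L′`. [cite: HaoLoeffler2025, Thm. 3.5, remark (arXiv:2405.12611)]
[cite: Gouvea1993PadicNumbers, §5.6 Cor. 5.6.3–5.6.4] [cite: Jacquet1972, §19 Cor. 19.15] -/
theorem norm_le_norm_of_isToricTwoVarLFunctionUpTo₂_pair (hJ : jacquet1972_functionalEquation_rankinSelbergHecke_cone)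
    (hK : IsImaginaryQuadratic K) {N : ℕ} [NeZero N] (W : WeierstrassCurve ℚ)
    (Dt : Literature.NumberTheory.EllipticCurves.ModularForms.ModularParametrizationData W N)
    (hH : SatisfiesHeegnerHypothesis N K)
    {𝔭 : HeightOneSpectrum (𝓞 K)} (h3 : ((3 : ℕ) : 𝓞 K) ∈ 𝔭.asIdeal)
    {𝔭' : HeightOneSpectrum (𝓞 K)} (h3' : ((3 : ℕ) : 𝓞 K) ∈ 𝔭'.asIdeal) (hne : 𝔭' ≠ 𝔭)
    (ι' : PadicAlgCl 3 ≃+* ℂ) (hι : Summit.BirchSwinnertonDyer.BirchSwinnertonDyer.Theorems.SchneiderFree.BranchInducesPrime 3 ι' 𝔭)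
    {κ₁ κ₂ : ZpExtension K 3} {γ₁ γ₂ : absoluteGaloisGroup K} (hpair : ZpExtension.IsTopGeneratorPair κ₁ κ₂ γ₁ γ₂)
    (hur₁ : ∀ v : HeightOneSpectrum (𝓞 K), v ≠ 𝔭 → ∀ 𝔓 ∈ v.primesAbove,
      𝔓.inertia (absoluteGaloisGroup K) ≤ κ₁.kerSubgroup)
    {ΩK : ℂ} {C X Y C' X' Y' : ℂ_[3]} {L L' : PowerSeries (UnrSeries 3)} (hC : C ≠ 0) (hX : X ≠ 0) (hY : Y ≠ 0)
    (hL : IsToricTwoVarLFunctionUpTo₂ C X Y ι' 𝔭 𝔭' κ₁ κ₂ γ₁ γ₂ Dt.f ΩK L)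
    (hL' : IsToricTwoVarLFunctionUpTo₂ C' X' Y' ι' 𝔭 𝔭' κ₁ κ₂ γ₁ γ₂ Dt.f ΩK L') (hL'0 : L' ≠ 0) :
    ‖X‖ ≤ ‖X'‖ := by
  -- the frame involution data (only to call the grid supply) and the grid
  obtain ⟨c, hc⟩ := FrameInvolution.exists_not_mem_range_absGaloisRestrict_rat hK
  obtain ⟨τ, hτ⟩ := FrameInvolution.exists_conjInv hK.1 c
  obtain ⟨u, v₁, v₂, m, hm, hu, hv₁, hv₂, hut, hv₂t, grid⟩ :=
    GridSupply.gridSupply hJ (by norm_num) hK W Dt hH h3 h3' hne ι' hι hpair hur₁ hc hτ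
  choose ψ r Lc hinf hunr hr hrκ hLd hLe hx hy using grid
  have h31 : ‖((3 : ℕ) : ℂ_[3])‖ < 1 := norm_prime_padicComplex_lt_one
  have h30 : ((3 : ℕ) : ℂ_[3]) ≠ 0 := by exact_mod_cast (show (3 : ℕ) ≠ 0 by norm_num)
  have hu1 : ‖u - 1‖ ≤ 1 := (hu.trans h31).le
  have hv₁1 : ‖v₁ - 1‖ ≤ 1 := (hv₁.trans h31).le
  have hv₂1 : ‖v₂ - 1‖ ≤ 1 := (hv₂.trans h31).le
  have hu_ne : u ≠ 0 := fun h ↦ by rw [h, zero_sub, norm_neg, norm_one] at hu; exact (lt_irrefl _) (hu.trans h31)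
  have hv₁_ne : v₁ ≠ 0 := fun h ↦ by rw [h, zero_sub, norm_neg, norm_one] at hv₁; exact (lt_irrefl _) (hv₁.trans h31)
  have hv₂_ne : v₂ ≠ 0 := fun h ↦ by rw [h, zero_sub, norm_neg, norm_one] at hv₂; exact (lt_irrefl _) (hv₂.trans h31)
  have hv₁pow : ∀ j : ℕ, ‖v₁ ^ (j + 1) - 1‖ < ‖((3 : ℕ) : ℂ_[3])‖ := fun j ↦
    (RamifiedSevenEllipticUnits.LemmaXi.norm_pow_sub_one_le hv₁1 _).trans_lt hv₁
  have hv₂pow : ∀ j : ℕ, ‖v₂ ^ (j + 1) - 1‖ ≤ ‖((3 : ℕ) : ℂ_[3])‖ := fun j ↦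
    ((RamifiedSevenEllipticUnits.LemmaXi.norm_pow_sub_one_le hv₂1 _).trans_lt hv₂).le
  have hv₁n : ‖v₁‖ ≤ 1 := RamifiedSevenEllipticUnits.LemmaXi.norm_le_one_of_norm_sub_one_le_one hv₁1
  have hpt : ∀ i j : ℕ, ‖v₁ ^ (j + 1) * u ^ (i + 1) - 1‖ ≤ ‖((3 : ℕ) : ℂ_[3])‖ := fun i j ↦
    (FibredSupply.norm_mul_sub_one_lt (by rw [norm_pow]; exact pow_le_one₀ (norm_nonneg _) hv₁n) (hv₁pow j)
      ((RamifiedSevenEllipticUnits.LemmaXi.norm_pow_sub_one_le hu1 _).trans_lt hu)).le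
  have hinjD : Function.Injective fun j : ℕ ↦ v₂ ^ (j + 1) - 1 := by
    simpa only [one_mul] using FibredSupply.injective_mul_pow_sub_one one_ne_zero hv₂_ne hv₂t
  have hinjF : ∀ j : ℕ, Function.Injective fun i : ℕ ↦ v₁ ^ (j + 1) * u ^ (i + 1) - 1 := fun j ↦
    FibredSupply.injective_mul_pow_sub_one (pow_ne_zero _ hv₁_ne) hu_ne hut
  -- the common display values `D i j` and the two value families
  obtain ⟨D, hD⟩ : ∃ D : ℕ → ℕ → ℂ_[3], ∀ i j, D i j =
      (((ι'.symm (toricInterpolationValue 3 Dt.f 𝔭 𝔭' (ψ i j) (m * (i + 1)) (m * (j + 1)) ΩK (Lc i j 1))) : PadicAlgCl 3) :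
        ℂ_[3]) := ⟨_, fun _ _ ↦ rfl⟩
  obtain ⟨VL, hVL⟩ : ∃ VL : ℕ → ℕ → ℂ_[3], ∀ i j, VL i j = C * X ^ (m * (i + 1)) * Y ^ (m * (j + 1)) * D i j :=
    ⟨_, fun _ _ ↦ rfl⟩
  obtain ⟨VL', hVL'⟩ : ∃ VL' : ℕ → ℕ → ℂ_[3], ∀ i j, VL' i j = C' * X' ^ (m * (i + 1)) * Y' ^ (m * (j + 1)) * D i j :=
    ⟨_, fun _ _ ↦ rfl⟩
  have ha : ∀ i : ℕ, 1 ≤ m * (i + 1) := fun i ↦ Nat.mul_pos hm (Nat.succ_pos i)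
  have hvalL : ∀ i j, UnrSeries.HasValueAt₂ L (v₁ ^ (j + 1) * u ^ (i + 1) - 1) (v₂ ^ (j + 1) - 1) (VL i j) := by
    intro i j
    have h := hL (ψ i j) _ _ (ha i) (ha j) (hinf i j) (hunr i j) (r i j) (hr i j) (hrκ i j) (Lc i j) (hLd i j) (hLe i j)
    rw [hx i j, hy i j, ← hD] at h
    rwa [hVL]
  have hvalL' : ∀ i j, UnrSeries.HasValueAt₂ L' (v₁ ^ (j + 1) * u ^ (i + 1) - 1) (v₂ ^ (j + 1) - 1) (VL' i j) := by
    intro i j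
    have h := hL' (ψ i j) _ _ (ha i) (ha j) (hinf i j) (hunr i j) (r i j) (hr i j) (hrκ i j) (Lc i j) (hLd i j) (hLe i j)
    rw [hx i j, hy i j, ← hD] at h
    rwa [hVL']
  have hnL : ∀ i j, ‖VL i j‖ ≤ 1 := fun i j ↦
    ValueLimits.norm_le_one_of_hasValueAt₂ (hvalL i j) ((hpt i j).trans h31.le) ((hv₂pow j).trans h31.le)
  -- the two value families interpolate the same `D i j`
  have hrel : ∀ i j, VL' i j * (C * X ^ (m * (i + 1)) * Y ^ (m * (j + 1))) =
      VL i j * (C' * X' ^ (m * (i + 1)) * Y' ^ (m * (j + 1))) := by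
    intro i j; rw [hVL, hVL']; ring
  -- suppose `‖X′‖ < ‖X‖`: geometric decay of `VL′` along every fibre
  by_contra hlt
  push Not at hlt
  have hXpos : 0 < ‖X‖ := norm_pos_iff.mpr hX
  have hYpos : 0 < ‖Y‖ := norm_pos_iff.mpr hY
  have hCpos : 0 < ‖C‖ := norm_pos_iff.mpr hC
  set θ : ℝ := (‖X'‖ / ‖X‖) ^ m with hθ
  have hθ0 : 0 ≤ θ := pow_nonneg (div_nonneg (norm_nonneg _) hXpos.le) m
  have hθ1 : θ < 1 := pow_lt_one₀ (div_nonneg (norm_nonneg _) hXpos.le) ((div_lt_one hXpos).mpr hlt) hm.ne'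
  -- the fibre constant `K_j = ‖C′‖/‖C‖ · (‖Y′‖/‖Y‖)^{m(j+1)}`
  have hbound : ∀ i j, ‖VL' i j‖ ≤ (‖C'‖ / ‖C‖ * (‖Y'‖ / ‖Y‖) ^ (m * (j + 1))) * θ ^ (i + 1) := by
    intro i j
    have hden : 0 < ‖C‖ * ‖X‖ ^ (m * (i + 1)) * ‖Y‖ ^ (m * (j + 1)) :=
      mul_pos (mul_pos hCpos (pow_pos hXpos _)) (pow_pos hYpos _)
    have h1 : ‖VL' i j‖ * (‖C‖ * ‖X‖ ^ (m * (i + 1)) * ‖Y‖ ^ (m * (j + 1))) ≤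
        ‖C'‖ * ‖X'‖ ^ (m * (i + 1)) * ‖Y'‖ ^ (m * (j + 1)) := by
      have h := congrArg (‖·‖) (hrel i j)
      simp only [norm_mul, norm_pow] at h
      rw [h]
      calc ‖VL i j‖ * (‖C'‖ * ‖X'‖ ^ (m * (i + 1)) * ‖Y'‖ ^ (m * (j + 1)))
          ≤ 1 * (‖C'‖ * ‖X'‖ ^ (m * (i + 1)) * ‖Y'‖ ^ (m * (j + 1))) :=
            mul_le_mul_of_nonneg_right (hnL i j) (by positivity)
        _ = ‖C'‖ * ‖X'‖ ^ (m * (i + 1)) * ‖Y'‖ ^ (m * (j + 1)) := one_mul _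
    rw [← le_div_iff₀ hden] at h1
    refine h1.trans (le_of_eq ?_)
    rw [hθ, ← pow_mul, div_pow, div_pow, pow_mul]
    field_simp
  apply hL'0
  refine ReflectionTransfer.unr_eq_zero_of_infinite_zeros₂_innerFibred h30 h31 (Set.infinite_range_of_injective hinjD) ?_ ?_
  · rintro y ⟨j, rfl⟩; exact hv₂pow j
  · rintro y ⟨j, rfl⟩
    refine Set.infinite_of_injective_forall_mem (hinjF j) fun i ↦ ⟨hpt i j, ?_⟩
    have hz := ValueLimits.eq_zero_of_hasValueAt₂_of_norm_le_geometric hu (hv₁pow j) (hv₂pow j)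
      (fun i ↦ hvalL' i j) (by positivity) hθ0 hθ1 (fun i ↦ hbound i j) i
    have hv := hvalL' i j
    rwa [hz] at hv

/-! ### §3. Size invariance -/

/-- **SIZE INVARIANCE OF ♯♯-FRAMES (same period).** Two NON-ZERO ♯♯-frames `L` (constants `(C, X, Y)`) and `L′` (constants `(C′, X′, Y′)`) of the
same datum `(ι′, 𝔭, 𝔭′, κ₁, κ₂, γ₁, γ₂, f_E, Ω_K)`, all constants non-zero, have `‖X‖ = ‖X′‖` and `‖Y‖ = ‖Y′‖`: §2 in both directions for the
first grading, then size rigidity `‖Y‖ = ‖X·κ̂‖` (`…ThinComb.SizeRigidity`) for each frame. The absolute `3`-adic sizes of the two gradings are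
invariants of the branch, not choices. [cite: HaoLoeffler2025, Thm. 3.5, remark (arXiv:2405.12611)] [cite: Hida1988AIF, §5 Lemma 5.2 (ii)]
[cite: Jacquet1972, §19 Cor. 19.15] -/
theorem norm_eq_norm_of_isToricTwoVarLFunctionUpTo₂_pair (hJ : jacquet1972_functionalEquation_rankinSelbergHecke_cone)
    (hK : IsImaginaryQuadratic K) {N : ℕ} [NeZero N] (W : WeierstrassCurve ℚ)
    (Dt : Literature.NumberTheory.EllipticCurves.ModularForms.ModularParametrizationData W N)
    (hH : SatisfiesHeegnerHypothesis N K)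
    {𝔭 : HeightOneSpectrum (𝓞 K)} (h3 : ((3 : ℕ) : 𝓞 K) ∈ 𝔭.asIdeal)
    {𝔭' : HeightOneSpectrum (𝓞 K)} (h3' : ((3 : ℕ) : 𝓞 K) ∈ 𝔭'.asIdeal) (hne : 𝔭' ≠ 𝔭)
    (ι' : PadicAlgCl 3 ≃+* ℂ) (hι : Summit.BirchSwinnertonDyer.BirchSwinnertonDyer.Theorems.SchneiderFree.BranchInducesPrime 3 ι' 𝔭)
    {κ₁ κ₂ : ZpExtension K 3} {γ₁ γ₂ : absoluteGaloisGroup K} (hpair : ZpExtension.IsTopGeneratorPair κ₁ κ₂ γ₁ γ₂)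
    (hur₁ : ∀ v : HeightOneSpectrum (𝓞 K), v ≠ 𝔭 → ∀ 𝔓 ∈ v.primesAbove,
      𝔓.inertia (absoluteGaloisGroup K) ≤ κ₁.kerSubgroup)
    {ΩK : ℂ} {C X Y C' X' Y' : ℂ_[3]} {L L' : PowerSeries (UnrSeries 3)}
    (hC : C ≠ 0) (hX : X ≠ 0) (hY : Y ≠ 0) (hC' : C' ≠ 0) (hX' : X' ≠ 0) (hY' : Y' ≠ 0)
    (hL : IsToricTwoVarLFunctionUpTo₂ C X Y ι' 𝔭 𝔭' κ₁ κ₂ γ₁ γ₂ Dt.f ΩK L) (hL0 : L ≠ 0)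
    (hL' : IsToricTwoVarLFunctionUpTo₂ C' X' Y' ι' 𝔭 𝔭' κ₁ κ₂ γ₁ γ₂ Dt.f ΩK L') (hL'0 : L' ≠ 0) :
    ‖X‖ = ‖X'‖ ∧ ‖Y‖ = ‖Y'‖ := by
  have hXX : ‖X‖ = ‖X'‖ :=
    le_antisymm (norm_le_norm_of_isToricTwoVarLFunctionUpTo₂_pair hJ hK W Dt hH h3 h3' hne ι' hι hpair hur₁ hC hX hY hL hL' hL'0)
      (norm_le_norm_of_isToricTwoVarLFunctionUpTo₂_pair hJ hK W Dt hH h3 h3' hne ι' hι hpair hur₁ hC' hX' hY' hL' hL hL0)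
  refine ⟨hXX, ?_⟩
  have hYs := SizeRigidity.norm_mul_eq_norm_of_isToricTwoVarLFunctionUpTo₂ hJ hK W Dt hH h3 h3' hne ι' hι hpair hur₁ hX hY hL hL0
  have hY's := SizeRigidity.norm_mul_eq_norm_of_isToricTwoVarLFunctionUpTo₂ hJ hK W Dt hH h3 h3' hne ι' hι hpair hur₁ hX' hY' hL' hL'0
  rw [← hYs, ← hY's, norm_mul, norm_mul, hXX]

/-- **SIZE INVARIANCE OF ♯♯-FRAMES (arbitrary periods).** For two NON-ZERO ♯♯-frames `L` (constants `(C, X, Y)`, period `Ω_K ≠ 0`) and `L′`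
(constants `(C′, X′, Y′)`, period `Ω_K′ ≠ 0`) of the same datum, all constants non-zero: `‖X·ι′⁻¹(Ω_K⁻²)‖ = ‖X′·ι′⁻¹(Ω_K′⁻²)‖` and
`‖Y·ι′⁻¹(Ω_K⁻²)‖ = ‖Y′·ι′⁻¹(Ω_K′⁻²)‖` — transport both frames to the period `1` (§1) and apply the same-period invariance.
[cite: HaoLoeffler2025, Thm. 3.5, remark (arXiv:2405.12611)] [cite: CastellaWan2023, §2.4 Thm. 2.11 (arXiv:1607.02019)] -/
theorem norm_mul_eq_norm_mul_of_isToricTwoVarLFunctionUpTo₂_pair (hJ : jacquet1972_functionalEquation_rankinSelbergHecke_cone)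
    (hK : IsImaginaryQuadratic K) {N : ℕ} [NeZero N] (W : WeierstrassCurve ℚ)
    (Dt : Literature.NumberTheory.EllipticCurves.ModularForms.ModularParametrizationData W N)
    (hH : SatisfiesHeegnerHypothesis N K)
    {𝔭 : HeightOneSpectrum (𝓞 K)} (h3 : ((3 : ℕ) : 𝓞 K) ∈ 𝔭.asIdeal)
    {𝔭' : HeightOneSpectrum (𝓞 K)} (h3' : ((3 : ℕ) : 𝓞 K) ∈ 𝔭'.asIdeal) (hne : 𝔭' ≠ 𝔭)
    (ι' : PadicAlgCl 3 ≃+* ℂ) (hι : Summit.BirchSwinnertonDyer.BirchSwinnertonDyer.Theorems.SchneiderFree.BranchInducesPrime 3 ι' 𝔭)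
    {κ₁ κ₂ : ZpExtension K 3} {γ₁ γ₂ : absoluteGaloisGroup K} (hpair : ZpExtension.IsTopGeneratorPair κ₁ κ₂ γ₁ γ₂)
    (hur₁ : ∀ v : HeightOneSpectrum (𝓞 K), v ≠ 𝔭 → ∀ 𝔓 ∈ v.primesAbove,
      𝔓.inertia (absoluteGaloisGroup K) ≤ κ₁.kerSubgroup)
    {ΩK ΩK' : ℂ} {C X Y C' X' Y' : ℂ_[3]} {L L' : PowerSeries (UnrSeries 3)} (hΩK : ΩK ≠ 0) (hΩK' : ΩK' ≠ 0)
    (hC : C ≠ 0) (hX : X ≠ 0) (hY : Y ≠ 0) (hC' : C' ≠ 0) (hX' : X' ≠ 0) (hY' : Y' ≠ 0)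
    (hL : IsToricTwoVarLFunctionUpTo₂ C X Y ι' 𝔭 𝔭' κ₁ κ₂ γ₁ γ₂ Dt.f ΩK L) (hL0 : L ≠ 0)
    (hL' : IsToricTwoVarLFunctionUpTo₂ C' X' Y' ι' 𝔭 𝔭' κ₁ κ₂ γ₁ γ₂ Dt.f ΩK' L') (hL'0 : L' ≠ 0) :
    ‖X * (((ι'.symm ((ΩK ^ 2)⁻¹) : PadicAlgCl 3)) : ℂ_[3])‖ = ‖X' * (((ι'.symm ((ΩK' ^ 2)⁻¹) : PadicAlgCl 3)) : ℂ_[3])‖ ∧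
      ‖Y * (((ι'.symm ((ΩK ^ 2)⁻¹) : PadicAlgCl 3)) : ℂ_[3])‖ = ‖Y' * (((ι'.symm ((ΩK' ^ 2)⁻¹) : PadicAlgCl 3)) : ℂ_[3])‖ := by
  have hρ : ∀ {Ω : ℂ}, Ω ≠ 0 → (((ι'.symm ((Ω ^ 2)⁻¹) : PadicAlgCl 3)) : ℂ_[3]) ≠ 0 := by
    intro Ω hΩ
    rw [PadicComplex.coe_eq, map_ne_zero_iff _ (algebraMap (PadicAlgCl 3) ℂ_[3]).injective, map_ne_zero_iff _ ι'.symm.injective]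
    exact inv_ne_zero (pow_ne_zero _ hΩ)
  exact norm_eq_norm_of_isToricTwoVarLFunctionUpTo₂_pair hJ hK W Dt hH h3 h3' hne ι' hι hpair hur₁
    hC (mul_ne_zero hX (hρ hΩK)) (mul_ne_zero hY (hρ hΩK)) hC' (mul_ne_zero hX' (hρ hΩK')) (mul_ne_zero hY' (hρ hΩK'))
    (isToricTwoVarLFunctionUpTo₂_period_one hΩK hL) hL0 (isToricTwoVarLFunctionUpTo₂_period_one hΩK' hL') hL'0

end Summit.BirchSwinnertonDyer.BirchSwinnertonDyer.Theorems.UniversalToricDescentThinComb.FrameSizeInvariance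

end
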